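import Summits.AtomisticToContinuum.FouriersLaw.Theorems.HonestZwanzigRobinCoercivityStubBlockForm
import Summits.AtomisticToContinuum.FouriersLaw.Theorems.HonestZwanzigOrthogonalOhmFixedNLimits
import Summits.AtomisticToContinuum.FouriersLaw.Theorems.HonestZwanzigOrthogonalOhmG0PosDef

/-!
# `HonestZwanzig.RobinCoercivity`, line `limit-operator-memory-form`: the `θ = 0` end of bulk symbol positivity

Support file for the crux `stmt-AtomisticToContinuum-12695` (`RobinCoercivity` of route `HonestZwanzig`, sub-problem
`FouriersLaw`), line `limit-operator-memory-form`, registered LINK lemma `symbolZero_pos_of_positiveMemory`: the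
`θ = 0` case of the open stub (Q1) `stub_symbolPositivity` — `Σ'_z K(z) > 0` for every bulk Toeplitz limit `K` of the
block memory matrix `W_N(s)` (hypothesis shape of `stub_bulkLimit`, rev 2) — follows from the route's rank-3 crux
`PositiveMemory` together with the line's open input (U′) `stub_bandDomination` (uniform off-band `ℓ¹` row tails `τ`).

Proof. Positions `i : Fin (N+1)` (`0`, `N` = contacts, `1 … N−1` = bonds `b = i − 1`). For a bond position `i` the
position observable is `g_i = j_{i−1}`, odd in `p`, so the row of the block memory matrix is
`W_N(s)_{ij} = schur_s(j_{i−1}, g_j)` and its sum over the BOND columns is `schur_s(j_{i−1}, J)`, `J = Σ_b j_b`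
(second-slot linearity of the Schur pairing, `bulk_row_sum_pkg`). At fixed `N` the limit
`ρ = lim_{s↓0} schur_s(j_b, J)` exists (`stub_fixedNLimits`' engine `tendsto_schur_of_isUnit_det`, with `det G(0) ≠ 0`
from `stub_G0PosDef`), so `PositiveMemory` gives `k₀ ≤ ρ` for bulk `b`; on the other hand, for `0 < s` small and `i`
deep in the bulk, the bond-column sum is `≤ Σ_{|z|≤Z} K(z) + (2Z+1)ε + τ(Z)` (window columns are `ε`-close to `K`,
off-window columns are absorbed by the band tail; `row_sum_le`, `bulk_row_limit`). Letting `ε → 0`, then `Z → ∞`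
(`Σ_{|z|≤Z} K(z) → Σ' K`, `τ(Z) → 0`; `le_of_window_bounds`) gives `0 < k₀ ≤ Σ'_z K(z)`.
-/

noncomputable section

open MeasureTheory Finset Matrix Filter Topology
open Literature.MathematicalPhysics.KineticTheory.HeatConduction
open Summit.AtomisticToContinuum.FouriersLaw.Theses.HonestZwanzig
open Summit.AtomisticToContinuum.FouriersLaw.Theorems.HonestZwanzig.NetworkReduction
open Summit.AtomisticToContinuum.FouriersLaw.Theorems.RobinCoercivity.Negative

namespace Summit.AtomisticToContinuum.FouriersLaw.Theorems.HonestZwanzig.Robin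

/-! ### Window bookkeeping on the positions `Fin (N+1)` and the two limits (pure analysis) -/

/-- Re-indexing the window `|i − j| ≤ Z` around a position `i` of `Fin (N+1)` at distance `≥ Z` from both ends by
the offset `z = i − j ∈ [−Z, Z]`. -/
theorem sum_window_offset {N Z : ℕ} (i : Fin (N + 1)) (hi1 : Z ≤ i.val) (hi2 : i.val + Z ≤ N) (F : ℤ → ℝ) :
    ∑ j : Fin (N + 1), (if i.val ≤ j.val + Z ∧ j.val ≤ i.val + Z then F ((i.val : ℤ) - j.val) else 0) =
      ∑ z ∈ Finset.Icc (-(Z : ℤ)) Z, F z := by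
  rw [← Finset.sum_filter]
  refine Finset.sum_nbij' (fun j => (i.val : ℤ) - j.val)
    (fun z => (⟨min ((i.val : ℤ) - z).toNat N, Nat.lt_succ_of_le (Nat.min_le_right _ _)⟩ : Fin (N + 1)))
    ?_ ?_ ?_ ?_ (fun j _ => rfl)
  · intro j hj
    simp only [Finset.mem_filter, Finset.mem_univ, true_and, Finset.mem_Icc] at hj ⊢
    omega
  · intro z hz
    simp only [Finset.mem_filter, Finset.mem_univ, true_and, Finset.mem_Icc] at hz ⊢
    omega
  · intro j hj
    simp only [Finset.mem_filter, Finset.mem_univ, true_and] at hj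
    exact Fin.ext (by dsimp only; omega)
  · intro z hz
    simp only [Finset.mem_Icc] at hz
    dsimp only
    omega

/-- Off the window `|i − j| ≤ Z` (natural-number form) the real distance exceeds `Z`. -/
theorem off_window_real {N Z : ℕ} (i j : Fin (N + 1)) (h : ¬(i.val ≤ j.val + Z ∧ j.val ≤ i.val + Z)) :
    (Z : ℝ) < |(i.val : ℝ) - j.val| := by
  rcases not_and_or.1 h with h1 | h1
  · have h2 : (j.val : ℝ) + Z < i.val := by exact_mod_cast (not_le.1 h1)
    exact lt_abs.2 (Or.inl (by linarith))
  · have h2 : (i.val : ℝ) + Z < j.val := by exact_mod_cast (not_le.1 h1)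
    exact lt_abs.2 (Or.inr (by linarith))

/-- **Row bound.** A row `w` on the positions `Fin (N+1)` whose entries are `ε`-close to `K(i − j)` on the `R`-bulk
columns of the window `|i − j| ≤ Z` and whose off-window `ℓ¹` tail is `≤ τZ` has bond-column sum
`≤ Σ_{|z| ≤ Z} K(z) + (2Z+1)ε + τZ`, provided `i` is at distance `> R + Z` from both contacts. -/
theorem row_sum_le {N Z R : ℕ} (i : Fin (N + 1)) (hi1 : R + 1 + Z ≤ i.val) (hi2 : i.val + 1 + R + Z ≤ N)
    (w : Fin (N + 1) → ℝ) (K : ℤ → ℝ) (ε τZ : ℝ)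
    (hL : ∀ j : Fin (N + 1), R + 1 ≤ j.val → j.val + 1 + R ≤ N → i.val ≤ j.val + Z → j.val ≤ i.val + Z →
      |w j - K ((i.val : ℤ) - j.val)| ≤ ε)
    (hB : ∑ j : Fin (N + 1), (if (Z : ℝ) < |(i.val : ℝ) - j.val| then |w j| else 0) ≤ τZ) :
    ∑ j : Fin (N + 1), (if j.val ≠ 0 ∧ j.val ≠ N then w j else 0) ≤
      (∑ z ∈ Finset.Icc (-(Z : ℤ)) Z, K z) + ((2 * Z + 1 : ℕ) : ℝ) * ε + τZ := by
  have hterm : ∀ j : Fin (N + 1), (if j.val ≠ 0 ∧ j.val ≠ N then w j else 0) ≤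
      (if i.val ≤ j.val + Z ∧ j.val ≤ i.val + Z then K ((i.val : ℤ) - j.val) + ε else 0) +
        (if (Z : ℝ) < |(i.val : ℝ) - j.val| then |w j| else 0) := by
    intro j
    have hnn : 0 ≤ (if (Z : ℝ) < |(i.val : ℝ) - j.val| then |w j| else 0) := by
      split_ifs
      · exact abs_nonneg _
      · exact le_rfl
    by_cases hw : i.val ≤ j.val + Z ∧ j.val ≤ i.val + Z
    · rw [if_pos hw, if_pos (show j.val ≠ 0 ∧ j.val ≠ N by omega)]
      have h2 : w j ≤ K ((i.val : ℤ) - j.val) + ε := by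
        have := (abs_sub_le_iff.1 (hL j (by omega) (by omega) hw.1 hw.2)).1
        linarith
      linarith
    · rw [if_neg hw, if_pos (off_window_real i j hw), zero_add]
      split_ifs
      · exact le_abs_self _
      · exact abs_nonneg _
  have hwin : ∑ j : Fin (N + 1), (if i.val ≤ j.val + Z ∧ j.val ≤ i.val + Z then K ((i.val : ℤ) - j.val) + ε else 0) =
      (∑ z ∈ Finset.Icc (-(Z : ℤ)) Z, K z) + ((2 * Z + 1 : ℕ) : ℝ) * ε := by
    rw [sum_window_offset i (by omega) (by omega) (fun z => K z + ε), Finset.sum_add_distrib, Finset.sum_const,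
      Int.card_Icc, nsmul_eq_mul]
    congr 2
    norm_cast
    omega
  calc ∑ j : Fin (N + 1), (if j.val ≠ 0 ∧ j.val ≠ N then w j else 0)
      ≤ ∑ j : Fin (N + 1), ((if i.val ≤ j.val + Z ∧ j.val ≤ i.val + Z then K ((i.val : ℤ) - j.val) + ε else 0) +
          (if (Z : ℝ) < |(i.val : ℝ) - j.val| then |w j| else 0)) := Finset.sum_le_sum fun j _ => hterm j
    _ = (∑ z ∈ Finset.Icc (-(Z : ℤ)) Z, K z) + ((2 * Z + 1 : ℕ) : ℝ) * ε +
          ∑ j : Fin (N + 1), (if (Z : ℝ) < |(i.val : ℝ) - j.val| then |w j| else 0) := by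
        rw [Finset.sum_add_distrib, hwin]
    _ ≤ _ := by linarith

/-- The symmetric partial sums over `[−Z, Z]` of a summable `K : ℤ → ℝ` converge to `Σ' K`. -/
theorem tendsto_sum_Icc_symm (K : ℤ → ℝ) (hK : Summable K) :
    Tendsto (fun Z : ℕ => ∑ z ∈ Finset.Icc (-(Z : ℤ)) Z, K z) atTop (𝓝 (∑' z, K z)) :=
  hK.hasSum.comp (tendsto_atTop_finset_of_monotone (fun a b hab => Finset.Icc_subset_Icc (by omega) (by omega))
    (fun z => ⟨z.natAbs, by simp only [Finset.mem_Icc]; omega⟩))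

/-- From `k₀ ≤ S(Z) + (2Z+1)ε + τ(Z)` for all `ε > 0` and all `Z`, with `S(Z) → S` and `τ(Z) → 0`: `k₀ ≤ S`. -/
theorem le_of_window_bounds (k₀ S : ℝ) (SZ τ : ℕ → ℝ) (hS : Tendsto SZ atTop (𝓝 S)) (hτ : Tendsto τ atTop (𝓝 0))
    (h : ∀ (Z : ℕ) (ε : ℝ), 0 < ε → k₀ ≤ SZ Z + ((2 * Z + 1 : ℕ) : ℝ) * ε + τ Z) : k₀ ≤ S := by
  have step : ∀ Z : ℕ, k₀ ≤ SZ Z + τ Z := by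
    intro Z
    refine le_of_forall_pos_lt_add fun η hη => ?_
    have hc : (0 : ℝ) < ((2 * Z + 1 : ℕ) : ℝ) := by positivity
    have h1 := h Z (η / (2 * ((2 * Z + 1 : ℕ) : ℝ))) (by positivity)
    have h2 : ((2 * Z + 1 : ℕ) : ℝ) * (η / (2 * ((2 * Z + 1 : ℕ) : ℝ))) = η / 2 := by
      field_simp
    linarith
  have hlim : Tendsto (fun Z : ℕ => SZ Z + τ Z) atTop (𝓝 (S + 0)) := hS.add hτ
  rw [add_zero] at hlim
  exact ge_of_tendsto' hlim step

/-! ### The bond row of the block memory matrix at fixed `N` (abstract gadgets of the fixed-`N` package) -/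

section FixedN

variable {ω₂ lam β γ : ℝ} {N : ℕ} {T : ℝ}
  {Adm : (PhaseSpace N → ℝ) → Prop}
  {corr : (PhaseSpace N → ℝ) → (PhaseSpace N → ℝ) → ℝ → ℝ}
  {lap : ℝ → (PhaseSpace N → ℝ) → (PhaseSpace N → ℝ) → ℝ}
  {cov : (PhaseSpace N → ℝ) → (PhaseSpace N → ℝ) → ℝ}
  {e : Fin N → PhaseSpace N → ℝ}
  (hAdm : ∀ f, Adm f ↔ (Continuous f ∧ ∃ A : ℝ, ∀ z,
    |f z| ≤ A * Real.exp ((pinnedChain ω₂ lam β γ).hamiltonian N z / (8 * T))))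
  (hcorr : ∀ f g t, corr f g t =
    (∫ z, f z * (∫ y, g y ∂((pinnedChain ω₂ lam β γ).transitionKernel N T T t.toNNReal z))
      ∂(pinnedChain ω₂ lam β γ).gibbsMeasure N T) -
    (∫ z, f z ∂(pinnedChain ω₂ lam β γ).gibbsMeasure N T) *
      (∫ z, g z ∂(pinnedChain ω₂ lam β γ).gibbsMeasure N T))
  (hlap : ∀ s f g, lap s f g = ∫ t in Set.Ioi (0 : ℝ), Real.exp (-(s * t)) * corr f g t)
  (he : ∀ x z, e x z = z.2 x ^ 2 / 2 + (pinnedChain ω₂ lam β γ).U (z.1 x) +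
    ∑ j : Fin N, ((if j.val = x.val + 1 then (pinnedChain ω₂ lam β γ).V (z.1 j - z.1 x) / 2 else 0) +
      (if x.val = j.val + 1 then (pinnedChain ω₂ lam β γ).V (z.1 x - z.1 j) / 2 else 0)))
  (hFI : ∀ f g : PhaseSpace N → ℝ, Adm f → Adm g →
    Integrable f ((pinnedChain ω₂ lam β γ).gibbsMeasure N T) ∧
    (∀ t : ℝ, 0 ≤ t → Integrable (fun z => f z *
      (∫ y, g y ∂((pinnedChain ω₂ lam β γ).transitionKernel N T T t.toNNReal z)))
      ((pinnedChain ω₂ lam β γ).gibbsMeasure N T)) ∧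
    IntegrableOn (corr f g) (Set.Ioi 0) ∧
    (∀ t : ℝ, 0 ≤ t → corr f g t = corr (fun z => g (z.1, -z.2)) (fun z => f (z.1, -z.2)) t) ∧
    (∀ s : ℝ, 0 < s → ∀ x : Fin N,
      s * lap s (e x) g - cov (e x) g =
        lap s (fun z => (pinnedChain ω₂ lam β γ).generator N T T (e x) (z.1, -z.2)) g ∧
      s * lap s f (e x) - cov f (e x) = lap s f ((pinnedChain ω₂ lam β γ).generator N T T (e x))))
  (hω : 0 < ω₂) (hl : 0 ≤ lam) (hβ : 0 ≤ β) (hT : 0 < T)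
  (g : Fin (N + 1) → PhaseSpace N → ℝ)
  (hg : ∀ i z, g i z = (∑ b : Fin N, if b.val + 1 = i.val then (pinnedChain ω₂ lam β γ).bondCurrent N b z else 0) +
    (∑ x : Fin N, if (i.val = 0 ∧ x.val = 0) ∨ (i.val = N ∧ x.val + 1 = N) then
      (pinnedChain ω₂ lam β γ).γ * (T - z.2 x ^ 2) else 0))

include hg in
/-- At a bond position `i = b + 1 ≠ N` the position observable is the bond current `j_b`. -/
theorem bulk_g_eq (i : Fin (N + 1)) (b : Fin N) (hib : b.val + 1 = i.val) (hiN : i.val ≠ N) (z : PhaseSpace N) :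
    g i z = (pinnedChain ω₂ lam β γ).bondCurrent N b z := by
  have h1 : (∑ c : Fin N, if c.val + 1 = i.val then (pinnedChain ω₂ lam β γ).bondCurrent N c z else 0) =
      (pinnedChain ω₂ lam β γ).bondCurrent N b z :=
    sum_ite_eq_of_unique (fun c => (pinnedChain ω₂ lam β γ).bondCurrent N c z) b hib (fun c hc => Fin.ext (by omega))
  have h2 : (∑ x : Fin N, if (i.val = 0 ∧ x.val = 0) ∨ (i.val = N ∧ x.val + 1 = N) then
      (pinnedChain ω₂ lam β γ).γ * (T - z.2 x ^ 2) else 0) = 0 :=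
    Finset.sum_eq_zero fun x _ => if_neg (by omega)
  rw [hg, h1, h2, add_zero]

include hAdm hcorr hlap he hFI hω hl hβ hT hg in
/-- **Row-sum identity.** At a bond position `i = b + 1 ≤ N − 1` the row of the block memory matrix
`W_{ij} = γT²[i = j contact] − schur_s(g_i∘Θ, g_j)` is `schur_s(j_b, g_j)`, and its sum over the bond columns
`1 … N−1` is `schur_s(j_b, J)` with `J = Σ_c j_c` (the phantom current `j_{N−1}` vanishes). -/
theorem bulk_row_sum_pkg {s : ℝ} (hs : 0 ≤ s) (G : Matrix (Fin N) (Fin N) ℝ)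
    (schur : (PhaseSpace N → ℝ) → (PhaseSpace N → ℝ) → ℝ)
    (hschur : ∀ f g, schur f g = lap s f g - ∑ u, ∑ v, lap s f (e u) * G⁻¹ u v * lap s (e v) g)
    (W : Fin (N + 1) → Fin (N + 1) → ℝ)
    (hW : ∀ i j, W i j = (if i = j ∧ (i.val = 0 ∨ i.val = N) then (pinnedChain ω₂ lam β γ).γ * T ^ 2 else 0) -
      schur (fun z => g i (z.1, -z.2)) (g j))
    (i : Fin (N + 1)) (b : Fin N) (hib : b.val + 1 = i.val) (hiN : i.val ≠ N) :
    ∑ j : Fin (N + 1), (if j.val ≠ 0 ∧ j.val ≠ N then W i j else 0) =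
      schur ((pinnedChain ω₂ lam β γ).bondCurrent N b)
        (fun z => ∑ c : Fin N, (pinnedChain ω₂ lam β γ).bondCurrent N c z) := by
  have hgi : (fun z : PhaseSpace N => g i (z.1, -z.2)) =
      fun z => (-1 : ℝ) * (pinnedChain ω₂ lam β γ).bondCurrent N b z := by
    funext z
    rw [bulk_g_eq g hg i b hib hiN (z.1, -z.2), OscillatorChain.bondCurrent_neg_momentum]
    ring
  have hWj : ∀ j, W i j = schur ((pinnedChain ω₂ lam β γ).bondCurrent N b) (g j) := by
    intro j
    have hc : ¬(i = j ∧ (i.val = 0 ∨ i.val = N)) := fun h => by omega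
    rw [hW, if_neg hc, hgi, schur_const_mul_left' hcorr hlap s G schur hschur]
    ring
  have hadm_g : ∀ j, Adm (g j) := fun j => blockForm_adm_g hAdm hω hl hβ hT g hg j
  rw [← Finset.sum_filter, Finset.sum_congr rfl fun j _ => hWj j,
    sum_schur_right hAdm hcorr hlap he hFI hω hl hβ hT hs G schur hschur _ g (fun j _ => hadm_g j)
      (adm_bondCurrent Adm hAdm hω hl hβ hT b)]
  congr 1
  funext z
  rw [Finset.sum_filter, Fin.sum_univ_succ]
  have h0 : (if ((0 : Fin (N + 1)) : ℕ) ≠ 0 ∧ ((0 : Fin (N + 1)) : ℕ) ≠ N then g 0 z else 0) = 0 := if_neg (by simp)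
  rw [h0, zero_add]
  refine Finset.sum_congr rfl fun c _ => ?_
  by_cases hc : c.val + 1 < N
  · rw [if_pos (by rw [Fin.val_succ]; omega)]
    exact bulk_g_eq g hg c.succ c (Fin.val_succ c).symm (by rw [Fin.val_succ]; omega) z
  · rw [if_neg (by rw [Fin.val_succ]; omega), bondCurrent_eq_zero_of_last _ c hc z]

end FixedN

/-- **The bond row at fixed `N`, canonical objects.** For `pinnedChain ω₂ lam β γ` (all `> 0`), `T > 0`, `N ≥ 2` and
the line's gadgets `lap, e, G, schur, g, W` with their defining equations: if for `0 < s < s₀` the rows of `W_N(s)`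
have off-band tails `Σ_{|i−j| > d}|W_{ij}| ≤ τ(d)` and the `R`-bulk entries at mutual distance `≤ Z` are `ε`-close to
`K(i − j)`, then at a bond `b = i − 1` with `i` at distance `> R + Z` from both contacts the orthogonal DC response
`ρ = lim_{s↓0} schur_s(j_b, J)` exists and `ρ ≤ Σ_{|z| ≤ Z} K(z) + (2Z+1)ε + τ(Z)`. -/
theorem bulk_row_limit {ω₂ lam β γ T : ℝ} (hω : 0 < ω₂) (hl : 0 < lam) (hβ : 0 < β) (hγ : 0 < γ) (hT : 0 < T)
    {N : ℕ} (hN : 2 ≤ N)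
    (lap : ℝ → (PhaseSpace N → ℝ) → (PhaseSpace N → ℝ) → ℝ) (e : Fin N → PhaseSpace N → ℝ)
    (G : ℝ → Matrix (Fin N) (Fin N) ℝ) (schur : ℝ → (PhaseSpace N → ℝ) → (PhaseSpace N → ℝ) → ℝ)
    (g : Fin (N + 1) → PhaseSpace N → ℝ) (W : ℝ → Fin (N + 1) → Fin (N + 1) → ℝ)
    (hlap : ∀ s f₁ f₂, lap s f₁ f₂ = ∫ t in Set.Ioi (0 : ℝ), Real.exp (-(s * t)) *
      ((∫ z, f₁ z * (∫ y, f₂ y ∂((pinnedChain ω₂ lam β γ).transitionKernel N T T t.toNNReal z))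
          ∂(pinnedChain ω₂ lam β γ).gibbsMeasure N T) -
        (∫ z, f₁ z ∂(pinnedChain ω₂ lam β γ).gibbsMeasure N T) *
          (∫ z, f₂ z ∂(pinnedChain ω₂ lam β γ).gibbsMeasure N T)))
    (he : ∀ x z, e x z = z.2 x ^ 2 / 2 + (pinnedChain ω₂ lam β γ).U (z.1 x) +
      ∑ j : Fin N, ((if j.val = x.val + 1 then (pinnedChain ω₂ lam β γ).V (z.1 j - z.1 x) / 2 else 0) +
        (if x.val = j.val + 1 then (pinnedChain ω₂ lam β γ).V (z.1 x - z.1 j) / 2 else 0)))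
    (hG : ∀ s, G s = Matrix.of fun x y => lap s (e x) (e y))
    (hschur : ∀ s f₁ f₂, schur s f₁ f₂ = lap s f₁ f₂ - ∑ x, ∑ y, lap s f₁ (e x) * (G s)⁻¹ x y * lap s (e y) f₂)
    (hg : ∀ i z, g i z = (∑ b : Fin N, if b.val + 1 = i.val then (pinnedChain ω₂ lam β γ).bondCurrent N b z else 0) +
      (∑ x : Fin N, if (i.val = 0 ∧ x.val = 0) ∨ (i.val = N ∧ x.val + 1 = N) then
        (pinnedChain ω₂ lam β γ).γ * (T - z.2 x ^ 2) else 0))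
    (hW : ∀ s i j, W s i j = (if i = j ∧ (i.val = 0 ∨ i.val = N) then (pinnedChain ω₂ lam β γ).γ * T ^ 2 else 0) -
      schur s (fun z => g i (z.1, -z.2)) (g j))
    (K : ℤ → ℝ) (ε s₀ : ℝ) (hs₀ : 0 < s₀) (τ : ℕ → ℝ) (Z R : ℕ) (i : Fin (N + 1)) (b : Fin N)
    (hib : b.val + 1 = i.val) (hi1 : R + 1 + Z ≤ i.val) (hi2 : i.val + 1 + R + Z ≤ N)
    (hBi : ∀ s : ℝ, 0 < s → s < s₀ → ∀ (i : Fin (N + 1)) (d : ℕ),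
      ∑ j : Fin (N + 1), (if (d : ℝ) < |(i.val : ℝ) - j.val| then |W s i j| else 0) ≤ τ d)
    (hLi : ∀ s : ℝ, 0 < s → s < s₀ → ∀ i j : Fin (N + 1),
      R + 1 ≤ i.val → i.val + 1 + R ≤ N → R + 1 ≤ j.val → j.val + 1 + R ≤ N →
      i.val ≤ j.val + Z → j.val ≤ i.val + Z → |W s i j - K ((i.val : ℤ) - j.val)| ≤ ε) :
    ∃ ρ : ℝ, Tendsto (fun s => schur s ((pinnedChain ω₂ lam β γ).bondCurrent N b)
        (fun z => ∑ c : Fin N, (pinnedChain ω₂ lam β γ).bondCurrent N c z)) (nhdsWithin (0 : ℝ) (Set.Ioi 0)) (nhds ρ) ∧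
      ρ ≤ (∑ z ∈ Finset.Icc (-(Z : ℤ)) Z, K z) + ((2 * Z + 1 : ℕ) : ℝ) * ε + τ Z := by
  classical
  obtain rfl : lap = fun s f g => ∫ t in Set.Ioi (0 : ℝ), Real.exp (-(s * t)) *
      ((∫ z, f z * (∫ y, g y ∂((pinnedChain ω₂ lam β γ).transitionKernel N T T t.toNNReal z))
          ∂(pinnedChain ω₂ lam β γ).gibbsMeasure N T) -
        (∫ z, f z ∂(pinnedChain ω₂ lam β γ).gibbsMeasure N T) *
          (∫ z, g z ∂(pinnedChain ω₂ lam β γ).gibbsMeasure N T)) :=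
    funext fun s => funext fun f => funext fun g => hlap s f g
  obtain rfl : e = fun x z => z.2 x ^ 2 / 2 + (pinnedChain ω₂ lam β γ).U (z.1 x) +
      ∑ j : Fin N, ((if j.val = x.val + 1 then (pinnedChain ω₂ lam β γ).V (z.1 j - z.1 x) / 2 else 0) +
        (if x.val = j.val + 1 then (pinnedChain ω₂ lam β γ).V (z.1 x - z.1 j) / 2 else 0)) :=
    funext fun x => funext fun z => he x z
  obtain ⟨-, hFI2, -, -⟩ := stub_feshbachIdentities ω₂ lam β γ hω hl hβ hγ T hT N hN
  have hG0 := stub_G0PosDef ω₂ lam β γ hω hl hβ hγ T hT N hN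
  dsimp only at hG0
  -- `det G(0) ≠ 0` from `G(0) ≻ 0`
  have hdet : IsUnit (G 0).det := by
    rw [isUnit_iff_ne_zero]
    intro hdet0
    obtain ⟨v, hv, hGv⟩ := Matrix.exists_mulVec_eq_zero_iff.2 hdet0
    have hq : ∑ x, ∑ y, v x * G 0 x y * v y = 0 := by
      have hx : ∀ x, ∑ y, v x * G 0 x y * v y = v x * (G 0 *ᵥ v) x := fun x => by
        rw [Matrix.mulVec_apply_eq_sum, Finset.mul_sum]
        exact Finset.sum_congr rfl fun y _ => by ring
      simp only [hx, hGv, Pi.zero_apply, mul_zero, Finset.sum_const_zero]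
    have hpos := hG0 v hv
    simp only [hG, Matrix.of_apply] at hq hpos
    exact hpos.ne' hq
  have hadm_b : (Continuous ((pinnedChain ω₂ lam β γ).bondCurrent N b) ∧ ∃ A : ℝ, ∀ z,
      |(pinnedChain ω₂ lam β γ).bondCurrent N b z| ≤
        A * Real.exp ((pinnedChain ω₂ lam β γ).hamiltonian N z / (8 * T))) :=
    adm_bondCurrent _ (fun f => Iff.rfl) hω hl.le hβ.le hT b
  have hadm_J := adm_totalCurrent (fun f : PhaseSpace N → ℝ => Continuous f ∧ ∃ A : ℝ, ∀ z,
      |f z| ≤ A * Real.exp ((pinnedChain ω₂ lam β γ).hamiltonian N z / (8 * T))) (fun f => Iff.rfl) hω hl.le hβ.le hT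
  have hlim := OrthogonalOhmLine.FixedNLimits.tendsto_schur_of_isUnit_det
    (corr := fun f₁ f₂ t => (∫ z, f₁ z * (∫ y, f₂ y ∂((pinnedChain ω₂ lam β γ).transitionKernel N T T
      t.toNNReal z)) ∂(pinnedChain ω₂ lam β γ).gibbsMeasure N T) -
      (∫ z, f₁ z ∂(pinnedChain ω₂ lam β γ).gibbsMeasure N T) * (∫ z, f₂ z ∂(pinnedChain ω₂ lam β γ).gibbsMeasure N T))
    (cov := fun f₁ f₂ => (∫ z, f₁ z * f₂ z ∂(pinnedChain ω₂ lam β γ).gibbsMeasure N T) -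
      (∫ z, f₁ z ∂(pinnedChain ω₂ lam β γ).gibbsMeasure N T) * (∫ z, f₂ z ∂(pinnedChain ω₂ lam β γ).gibbsMeasure N T))
    (G := G) (fun f => Iff.rfl) (fun s f g => rfl) (fun x z => rfl) (fun s x y => by rw [hG]; rfl) hschur hFI2 hω
    hl.le hβ.le hT hdet hadm_b hadm_J
  refine ⟨_, hlim, le_of_tendsto hlim ?_⟩
  filter_upwards [Ioo_mem_nhdsGT hs₀] with s hs
  rw [← bulk_row_sum_pkg (ω₂ := ω₂) (lam := lam) (β := β) (γ := γ) (N := N) (T := T)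
    (corr := fun f₁ f₂ t => (∫ z, f₁ z * (∫ y, f₂ y ∂((pinnedChain ω₂ lam β γ).transitionKernel N T T
      t.toNNReal z)) ∂(pinnedChain ω₂ lam β γ).gibbsMeasure N T) -
      (∫ z, f₁ z ∂(pinnedChain ω₂ lam β γ).gibbsMeasure N T) * (∫ z, f₂ z ∂(pinnedChain ω₂ lam β γ).gibbsMeasure N T))
    (cov := fun f₁ f₂ => (∫ z, f₁ z * f₂ z ∂(pinnedChain ω₂ lam β γ).gibbsMeasure N T) -
      (∫ z, f₁ z ∂(pinnedChain ω₂ lam β γ).gibbsMeasure N T) * (∫ z, f₂ z ∂(pinnedChain ω₂ lam β γ).gibbsMeasure N T))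
    (fun f => Iff.rfl) (fun f g t => rfl) (fun s f g => rfl) (fun x z => rfl) hFI2 hω hl.le hβ.le hT g hg hs.1.le
    (G s) (schur s) (hschur s) (W s) (hW s) i b hib (by omega)]
  exact row_sum_le i hi1 hi2 (W s i) K ε (τ Z) (fun j => hLi s hs.1 hs.2 i j (by omega) (by omega)) (hBi s hs.1 hs.2 i Z)

/-! ### The link lemma -/

/-- **`Σ'_z K(z) > 0` for every bulk limit, from `PositiveMemory` and band-domination** (registered link lemma of line
`limit-operator-memory-form`, crux `RobinCoercivity`): the `θ = 0` end of the open stub `stub_symbolPositivity` (Q1).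
Under the route's rank-3 crux `PositiveMemory` (`hPM`) and the line's open input (U′) `stub_bandDomination` (`hband`),
every summable `K : ℤ → ℝ` that is a bulk Toeplitz limit of the block memory matrix `W_N(s)` in the sense of
`stub_bulkLimit` (rev 2) has `0 < Σ'_z K(z)`: the bond-column row sums of `W_N(s)` are the orthogonal DC responses
`schur_s(j_b, J) → ρ_b ≥ k₀ > 0`, and they converge to `Σ' K` along `ε → 0`, `Z → ∞` thanks to the uniform tails. -/
theorem symbolZero_pos_of_positiveMemory (hPM : PositiveMemory)
    (hband : ∀ ω₂ lam β γ : ℝ, 0 < ω₂ → 0 < lam → 0 < β → 0 < γ → ∀ T : ℝ, 0 < T →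
      ∃ τ : ℕ → ℝ, Tendsto τ atTop (𝓝 0) ∧ ∀ N : ℕ, 2 ≤ N → ∃ s₀ : ℝ, 0 < s₀ ∧
      ∀ (lap : ℝ → (PhaseSpace N → ℝ) → (PhaseSpace N → ℝ) → ℝ) (e : Fin N → PhaseSpace N → ℝ)
        (G : ℝ → Matrix (Fin N) (Fin N) ℝ) (schur : ℝ → (PhaseSpace N → ℝ) → (PhaseSpace N → ℝ) → ℝ)
        (g : Fin (N + 1) → PhaseSpace N → ℝ) (W : ℝ → Fin (N + 1) → Fin (N + 1) → ℝ),
      (∀ s f₁ f₂, lap s f₁ f₂ = ∫ t in Set.Ioi (0 : ℝ), Real.exp (-(s * t)) *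
        ((∫ z, f₁ z * (∫ y, f₂ y ∂((pinnedChain ω₂ lam β γ).transitionKernel N T T t.toNNReal z))
            ∂(pinnedChain ω₂ lam β γ).gibbsMeasure N T) -
          (∫ z, f₁ z ∂(pinnedChain ω₂ lam β γ).gibbsMeasure N T) *
            (∫ z, f₂ z ∂(pinnedChain ω₂ lam β γ).gibbsMeasure N T))) →
      (∀ x z, e x z = z.2 x ^ 2 / 2 + (pinnedChain ω₂ lam β γ).U (z.1 x) +
        ∑ j : Fin N, ((if j.val = x.val + 1 then (pinnedChain ω₂ lam β γ).V (z.1 j - z.1 x) / 2 else 0) +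
          (if x.val = j.val + 1 then (pinnedChain ω₂ lam β γ).V (z.1 x - z.1 j) / 2 else 0))) →
      (∀ s, G s = Matrix.of fun x y => lap s (e x) (e y)) →
      (∀ s f₁ f₂, schur s f₁ f₂ = lap s f₁ f₂ - ∑ x, ∑ y, lap s f₁ (e x) * (G s)⁻¹ x y * lap s (e y) f₂) →
      (∀ i z, g i z = (∑ b : Fin N, if b.val + 1 = i.val then (pinnedChain ω₂ lam β γ).bondCurrent N b z else 0) +
        (∑ x : Fin N, if (i.val = 0 ∧ x.val = 0) ∨ (i.val = N ∧ x.val + 1 = N) then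
          (pinnedChain ω₂ lam β γ).γ * (T - z.2 x ^ 2) else 0)) →
      (∀ s i j, W s i j = (if i = j ∧ (i.val = 0 ∨ i.val = N) then (pinnedChain ω₂ lam β γ).γ * T ^ 2 else 0) -
        schur s (fun z => g i (z.1, -z.2)) (g j)) →
      ∀ s : ℝ, 0 < s → s < s₀ → ∀ (i : Fin (N + 1)) (d : ℕ),
        ∑ j : Fin (N + 1), (if (d : ℝ) < |(i.val : ℝ) - j.val| then |W s i j| else 0) ≤ τ d) :
    ∀ ω₂ lam β γ : ℝ, 0 < ω₂ → 0 < lam → 0 < β → 0 < γ → ∀ T : ℝ, 0 < T → ∀ K : ℤ → ℝ, Summable K →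
    (∀ ε : ℝ, 0 < ε → ∀ Z : ℕ, ∃ R : ℕ, ∀ N : ℕ, 2 ≤ N → ∃ s₀ : ℝ, 0 < s₀ ∧
      ∀ (lap : ℝ → (PhaseSpace N → ℝ) → (PhaseSpace N → ℝ) → ℝ) (e : Fin N → PhaseSpace N → ℝ)
        (G : ℝ → Matrix (Fin N) (Fin N) ℝ) (schur : ℝ → (PhaseSpace N → ℝ) → (PhaseSpace N → ℝ) → ℝ)
        (g : Fin (N + 1) → PhaseSpace N → ℝ) (W : ℝ → Fin (N + 1) → Fin (N + 1) → ℝ),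
      (∀ s f₁ f₂, lap s f₁ f₂ = ∫ t in Set.Ioi (0 : ℝ), Real.exp (-(s * t)) *
        ((∫ z, f₁ z * (∫ y, f₂ y ∂((pinnedChain ω₂ lam β γ).transitionKernel N T T t.toNNReal z))
            ∂(pinnedChain ω₂ lam β γ).gibbsMeasure N T) -
          (∫ z, f₁ z ∂(pinnedChain ω₂ lam β γ).gibbsMeasure N T) *
            (∫ z, f₂ z ∂(pinnedChain ω₂ lam β γ).gibbsMeasure N T))) →
      (∀ x z, e x z = z.2 x ^ 2 / 2 + (pinnedChain ω₂ lam β γ).U (z.1 x) +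
        ∑ j : Fin N, ((if j.val = x.val + 1 then (pinnedChain ω₂ lam β γ).V (z.1 j - z.1 x) / 2 else 0) +
          (if x.val = j.val + 1 then (pinnedChain ω₂ lam β γ).V (z.1 x - z.1 j) / 2 else 0))) →
      (∀ s, G s = Matrix.of fun x y => lap s (e x) (e y)) →
      (∀ s f₁ f₂, schur s f₁ f₂ = lap s f₁ f₂ - ∑ x, ∑ y, lap s f₁ (e x) * (G s)⁻¹ x y * lap s (e y) f₂) →
      (∀ i z, g i z = (∑ b : Fin N, if b.val + 1 = i.val then (pinnedChain ω₂ lam β γ).bondCurrent N b z else 0) +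
        (∑ x : Fin N, if (i.val = 0 ∧ x.val = 0) ∨ (i.val = N ∧ x.val + 1 = N) then
          (pinnedChain ω₂ lam β γ).γ * (T - z.2 x ^ 2) else 0)) →
      (∀ s i j, W s i j = (if i = j ∧ (i.val = 0 ∨ i.val = N) then (pinnedChain ω₂ lam β γ).γ * T ^ 2 else 0) -
        schur s (fun z => g i (z.1, -z.2)) (g j)) →
      ∀ s : ℝ, 0 < s → s < s₀ → ∀ i j : Fin (N + 1),
        R + 1 ≤ i.val → i.val + 1 + R ≤ N → R + 1 ≤ j.val → j.val + 1 + R ≤ N →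
        i.val ≤ j.val + Z → j.val ≤ i.val + Z → |W s i j - K ((i.val : ℤ) - j.val)| ≤ ε) →
    0 < ∑' z : ℤ, K z := by
  intro ω₂ lam β γ hω hl hβ hγ T hT K hK hL
  obtain ⟨k₀, hk₀, Rpm, hPMN⟩ := hPM ω₂ lam β γ hω hl hβ hγ T hT
  obtain ⟨τ, hτ, hBN⟩ := hband ω₂ lam β γ hω hl hβ hγ T hT
  refine hk₀.trans_le (le_of_window_bounds k₀ (∑' z, K z) (fun Z => ∑ z ∈ Finset.Icc (-(Z : ℤ)) Z, K z) τ
    (tendsto_sum_Icc_symm K hK) hτ fun Z ε hε => ?_)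
  obtain ⟨R, hR⟩ := hL ε hε Z
  -- `N = 2M + 2` sites, `M = Rpm + R + Z`; position `i = M + 1`, bond `b = M`
  obtain ⟨s₁, hs₁, hB⟩ := hBN (2 * (Rpm + R + Z) + 2) (by omega)
  obtain ⟨s₂, hs₂, hLn⟩ := hR (2 * (Rpm + R + Z) + 2) (by omega)
  have hP := hPMN (2 * (Rpm + R + Z) + 2) (by omega)
  dsimp only at hP
  have hB' := hB _ _ _ _ _ _ (fun _ _ _ => rfl) (fun _ _ => rfl) (fun _ => rfl) (fun _ _ _ => rfl) (fun _ _ => rfl)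
    (fun _ _ _ => rfl)
  have hL' := hLn _ _ _ _ _ _ (fun _ _ _ => rfl) (fun _ _ => rfl) (fun _ => rfl) (fun _ _ _ => rfl) (fun _ _ => rfl)
    (fun _ _ _ => rfl)
  obtain ⟨ρ, hρ, hρle⟩ := bulk_row_limit hω hl hβ hγ hT (N := 2 * (Rpm + R + Z) + 2) (by omega)
    _ _ _ _ _ _ (fun _ _ _ => rfl) (fun _ _ => rfl) (fun _ => rfl) (fun _ _ _ => rfl) (fun _ _ => rfl) (fun _ _ _ => rfl)
    K ε (min s₁ s₂) (lt_min hs₁ hs₂) τ Z R ⟨Rpm + R + Z + 1, by omega⟩ ⟨Rpm + R + Z, by omega⟩ rfl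
    (by show R + 1 + Z ≤ Rpm + R + Z + 1; omega) (by show Rpm + R + Z + 1 + 1 + R + Z ≤ 2 * (Rpm + R + Z) + 2; omega)
    (fun s hs hss => hB' s hs (lt_of_lt_of_le hss (min_le_left _ _)))
    (fun s hs hss => hL' s hs (lt_of_lt_of_le hss (min_le_right _ _)))
  exact (hP ⟨Rpm + R + Z, by omega⟩ (by show Rpm ≤ Rpm + R + Z; omega)
    (by show Rpm + R + Z + 2 + Rpm ≤ 2 * (Rpm + R + Z) + 2; omega) ρ hρ).trans hρle

end Summit.AtomisticToContinuum.FouriersLaw.Theorems.HonestZwanzig.Robin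

end
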